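import Mathlib

/-!
# Stub `stub_tailDeriv` of line `Sketch` (skeleton v6) for crux `TameOrBrodyR4` (stmt-SmoothPoincare4-7826, route SullivanDual)

Uniform decay of the `c`-derivative of the graph functions of a pencil. Let `g b : ℂ → ℂ` be
holomorphic on the exterior domain `{R < ‖c‖}` with `‖g b c - b‖ ≤ M` there and `g b c → b` at
infinity. Then `‖d(g b)(c)‖ ≤ ε` for `‖c‖ ≥ R₂(ε)`, with `R₂(ε) = max (4R) (2M/ε)` independent
of `b`. Proof:

* the Schwarz lemma at infinity (hypothesis `hS`, applied to `f := g b - b` with `R₁ := R`,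
  `R₂ := 2R`, `L := M`) gives `‖g b c - b‖ ≤ 2MR/‖c‖` for `‖c‖ ≥ 2R`;
* Cauchy's estimate (`Complex.norm_deriv_le_of_forall_mem_sphere_norm_le`) on the disc of radius
  `r := ‖c‖/2` about `c` (for `‖c‖ ≥ 4R` its closure lies in `{2R ≤ ‖z‖} ⊆ {R < ‖z‖}`): on the
  boundary circle `‖g b z - b‖ ≤ 2MR/‖z‖ ≤ ε r` as soon as moreover `‖c‖ ≥ 2M/ε`, whence
  `‖(g b)'(c)‖ ≤ ε r / r = ε`;
* `‖fderiv ℝ (g b) c‖ = ‖(g b)'(c)‖` (`DifferentiableAt.fderiv_restrictScalars`,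
  `ContinuousLinearMap.norm_restrictScalars`, `norm_deriv_eq_norm_fderiv`).

Sources: Cauchy's estimate — L. V. Ahlfors, *Complex Analysis* (1979), Ch. 4 §2.3 (Mathlib,
`Mathlib/Analysis/Complex/Liouville.lean`); the Schwarz lemma at infinity enters only as the
hypothesis `hS`.
-/

open scoped Topology
open Filter Set Function Metric Complex

-- the registered namespace `Summit.SmoothPoincare4.SmoothPoincare4.…` repeats a component
set_option linter.dupNamespace false

noncomputable section

namespace Summit.SmoothPoincare4.SmoothPoincare4.Cruxes.TameOrBrodyR4.Sketch

namespace TailDeriv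

/-- The operator norm of the real Fréchet derivative of a complex-differentiable function
`ℂ → ℂ` at a point is the norm of its complex derivative there. -/
theorem norm_fderiv_real_eq_norm_deriv {f : ℂ → ℂ} {c : ℂ} (hf : DifferentiableAt ℂ f c) :
    ‖fderiv ℝ f c‖ = ‖deriv f c‖ := by
  rw [hf.fderiv_restrictScalars ℝ, ContinuousLinearMap.norm_restrictScalars,
    norm_deriv_eq_norm_fderiv]

/-- Points of the closed disc of radius `r` about `c` have norm at least `‖c‖ - r`. -/
theorem norm_sub_le_norm_of_mem_closedBall {c z : ℂ} {r : ℝ} (hz : z ∈ closedBall c r) :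
    ‖c‖ - r ≤ ‖z‖ := by
  have h₁ : ‖c - z‖ ≤ r := mem_closedBall_iff_norm'.1 hz
  have h₂ : ‖c‖ - ‖z‖ ≤ ‖c - z‖ := norm_sub_norm_le c z
  linarith

/-- **Cauchy's estimate far out in an exterior domain.** If `f` is complex differentiable on
`{R < ‖z‖}`, `‖c‖ ≥ 4R`, `c ≠ 0`, and the values of `f` on the circle of radius `‖c‖ / 2` about
`c` are bounded by `ε * (‖c‖ / 2)`, then `‖deriv f c‖ ≤ ε` (the closed disc of radius `‖c‖ / 2`
about `c` lies in `{‖c‖ / 2 ≤ ‖z‖} ⊆ {R < ‖z‖}`). -/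
theorem norm_deriv_le_of_sphere_half {f : ℂ → ℂ} {R ε : ℝ} {c : ℂ}
    (hf : DifferentiableOn ℂ f {z : ℂ | R < ‖z‖}) (hc : 4 * R ≤ ‖c‖) (hc0 : 0 < ‖c‖)
    (hsph : ∀ z ∈ sphere c (‖c‖ / 2), ‖f z‖ ≤ ε * (‖c‖ / 2)) : ‖deriv f c‖ ≤ ε := by
  have hr0 : 0 < ‖c‖ / 2 := by positivity
  have hsub : closedBall c (‖c‖ / 2) ⊆ {z : ℂ | R < ‖z‖} := fun z hz => by
    have h := norm_sub_le_norm_of_mem_closedBall hz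
    show R < ‖z‖
    linarith
  have hd : DiffContOnCl ℂ f (ball c (‖c‖ / 2)) := hf.diffContOnCl_ball hsub
  have h := Complex.norm_deriv_le_of_forall_mem_sphere_norm_le hr0 hd hsph
  rwa [mul_div_assoc, div_self hr0.ne', mul_one] at h

end TailDeriv

/-- **Stub C2e (the `c`-derivative of the graph functions tends to `0`, uniformly in `b`).**
If every `g b` is holomorphic on `{R < ‖c‖}` with `‖g b c - b‖ ≤ M` there and `g b c → b` at
infinity, then for every `ε > 0` there is `R₂` (namely `max (4R) (2M/ε)`) with
`‖fderiv ℝ (g b) c‖ ≤ ε` for all `b` and all `‖c‖ ≥ R₂`. The Schwarz lemma at infinity is the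
hypothesis `hS`; the rest is Cauchy's estimate on the disc of radius `‖c‖/2` about `c`. -/
theorem stub_tailDeriv
    (hS : ∀ (f : ℂ → ℂ) (R₁ R₂ L : ℝ), 0 < R₁ → R₁ < R₂ → DifferentiableOn ℂ f {c | R₁ < ‖c‖} →
      (∃ M : ℝ, ∀ c, R₁ < ‖c‖ → ‖f c‖ ≤ M) → Tendsto f (cocompact ℂ) (𝓝 0) →
      (∀ c : ℂ, ‖c‖ = R₂ → ‖f c‖ ≤ L) → ∀ c : ℂ, R₂ ≤ ‖c‖ → ‖f c‖ ≤ L * R₂ / ‖c‖)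
    (R M : ℝ) (hR : 0 < R) (g : ℂ → ℂ → ℂ)
    (hgh : ∀ b, DifferentiableOn ℂ (g b) {c | R < ‖c‖})
    (hgb : ∀ b c : ℂ, R < ‖c‖ → ‖g b c - b‖ ≤ M)
    (hgl : ∀ b, Tendsto (g b) (cocompact ℂ) (𝓝 b)) :
    ∀ ε > 0, ∃ R₂ : ℝ, ∀ b c : ℂ, R₂ ≤ ‖c‖ → ‖fderiv ℝ (g b) c‖ ≤ ε := by
  -- `0 ≤ M`: the bound `hgb` holds at the point `2R` of the (nonempty) exterior domain
  have hM : 0 ≤ M := by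
    have h2R : R < ‖((2 * R : ℝ) : ℂ)‖ := by
      rw [Complex.norm_of_nonneg (by positivity)]
      linarith
    exact (norm_nonneg _).trans (hgb 0 _ h2R)
  -- Step 1: the Schwarz lemma at infinity for `f := g b - b` on `{R < ‖c‖}`, circle `‖c‖ = 2R`
  have h1 : ∀ b c : ℂ, 2 * R ≤ ‖c‖ → ‖g b c - b‖ ≤ M * (2 * R) / ‖c‖ := by
    intro b
    refine hS (fun c => g b c - b) R (2 * R) M hR (by linarith) ((hgh b).sub_const b)
      ⟨M, hgb b⟩ ?_ ?_
    · simpa using (hgl b).sub_const b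
    · intro c hc
      exact hgb b c (by rw [hc]; linarith)
  -- Steps 2–4: Cauchy's estimate on the disc of radius `‖c‖ / 2` about `c`
  intro ε hε
  refine ⟨max (4 * R) (2 * M / ε), fun b c hc => ?_⟩
  have h4R : 4 * R ≤ ‖c‖ := le_of_max_le_left hc
  have hMε : 2 * M ≤ ε * ‖c‖ := by
    have h := (div_le_iff₀ hε).1 (le_of_max_le_right hc)
    linarith
  have hc0 : 0 < ‖c‖ := by linarith
  -- the bound on the circle of radius `‖c‖ / 2` about `c`
  have hsph : ∀ z ∈ sphere c (‖c‖ / 2), ‖g b z - b‖ ≤ ε * (‖c‖ / 2) := by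
    intro z hz
    have hzr : ‖c‖ - ‖c‖ / 2 ≤ ‖z‖ :=
      TailDeriv.norm_sub_le_norm_of_mem_closedBall (sphere_subset_closedBall hz)
    have hz2 : 2 * R ≤ ‖z‖ := by linarith
    have hz0 : 0 < ‖z‖ := by linarith
    refine (h1 b z hz2).trans ?_
    rw [div_le_iff₀ hz0]
    -- `2MR ≤ M‖c‖/2 ≤ ε‖c‖²/4 ≤ ε (‖c‖/2) ‖z‖`
    have hA : M * (4 * R) ≤ M * ‖c‖ := mul_le_mul_of_nonneg_left h4R hM
    have hB : 2 * M * ‖c‖ ≤ ε * ‖c‖ * ‖c‖ := mul_le_mul_of_nonneg_right hMε (norm_nonneg c)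
    have hC : ε * (‖c‖ / 2) * (‖c‖ / 2) ≤ ε * (‖c‖ / 2) * ‖z‖ :=
      mul_le_mul_of_nonneg_left (by linarith) (by positivity)
    linarith
  have hderiv : ‖deriv (fun z => g b z - b) c‖ ≤ ε :=
    TailDeriv.norm_deriv_le_of_sphere_half ((hgh b).sub_const b) h4R hc0 hsph
  rw [deriv_sub_const] at hderiv
  -- `‖fderiv ℝ (g b) c‖ = ‖deriv (g b) c‖` at the interior point `c`
  have hdiff : DifferentiableAt ℂ (g b) c :=
    (hgh b).differentiableAt
      ((isOpen_lt continuous_const continuous_norm).mem_nhds (show R < ‖c‖ by linarith))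
  rw [TailDeriv.norm_fderiv_real_eq_norm_deriv hdiff]
  exact hderiv

end Summit.SmoothPoincare4.SmoothPoincare4.Cruxes.TameOrBrodyR4.Sketch
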